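import Mathlib
import Literature.NumberTheory.LFunctions.Zhang2022.TypedSection16ALeaves
import HarnessLib

/-!
# Zhang (2022) §16 p. 89: the integrand of `I₃⁺(ψ)` on `𝔍(1)` IS the integrand of `Θ₂(β₁,𝐤₂*,𝐚₂*)`

Topic `Literature/NumberTheory/LFunctions/Zhang2022` (Landau–Siegel audit tree; verdict-neutral).
Y. Zhang, *Discrete mean estimates and the Landau–Siegel zero*, arXiv:2211.02515v1 (2022)
[Zhang2022LandauSiegel] — **an unrefereed manuscript under adjudication; nothing in this file asserts or
denies its Theorems 1–2.** ZHANG-L discharge lane (WP16), leaf `Typed.Section16A.Step16_u010 c′`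
(node `Z22:§16.u010`, §16 p. 89, tex L4445):

> "We can rewrite (16.1) as `Φ₂ = Θ₂(β₁,𝐤₂*,𝐚₂*) + o(p)` with `κ₂* = κ₂ ∗ b₁` and `a₂* = g̃₂`."

The rewriting itself is an IDENTITY of Dirichlet series on the segment `𝔍(1)` (`Re s = 3/2 > 1`), which this
file proves in the kernel:

* `LRatio_mul_Bpoly_mul_Nchar_eq_tsum` — for `Re s > 1`,
  `(L(s+β₁,ψ)/L(s,ψ))·B(s,ψ)N(s+β₃,ψ) = Σ_m κ₂*(m)ψ(m)m^{−s}` with `κ₂* = κ₂ ∗ b₁`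
  (`Typed.Section16A.kappa2Star`): u007 (`B(s,ψ)N(s+β₃,ψ) = Σ_n b₁(n)ψ(n)n^{−s}`, the tree's
  `Typed.Section16ALeaves.convolution_bcoef_nN_eq_b1coef` with `Typed.Section17.Bpoly_eq_LSeries`,
  `Nchar_shift_eq_LSeries`) and u006 (`Σ κ₂(n)n^{−s} = ζ(s+β₁)/ζ(s)` twisted by `ψ`: the tree's
  `MeanSquareMajorant.LSeries_twist_conv_kappa₂`);
* `Kchar_eq_sum_Icc` — u008 in the range of `Θ₂`: `K(1−s−β₂,ψ̄) = Σ_{1≤n≤2P₄} g̃₂(n)ψ̄(n)n^{s−1}`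
  (from `Typed.Section16ALeaves.step16_u008_holds`; the index sets `[1,⌈2P₄⌉)` and `[1,⌊2P₄⌋]` differ at
  most by `n = 2P₄`, where `g̃₂(2P₄) = (2P₄)^{β₂}g*(1/2) = 0`);
* `calK2_mul_omega_eq_theta2Integrand` — hence for `Re s > 1` the integrand `𝒦₂(s,ψ)ω(s)` of `I₃⁺(ψ)`
  (`Typed.Section16A.calK2`, u001/u003) equals the integrand of `Skeleton.Theta2 χ β₁ κ₂* g̃₂` at `ψ`;
* `sum_I3pm_one_eq_Theta2` — **`Σ_{ψ∈Ψ₁}(p_ψt₀)^{β₁}I₃(ψ;𝔍(1)) = Θ₂(β₁,𝐤₂*,𝐚₂*)`** exactly (every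
  `D`, every real primitive `χ`), the segment `𝔍(1)` lying on `Re s = 3/2`.

So the analytic content of u010 is reduced to (i) the residue step u002, (ii) `I₃⁻(ψ) ≪ ε` (u004) and
(iii) the contour move `𝔍(α) → 𝔍(1)` for `I₃⁺` — handled in sibling files of the lane. Theorems only:
no new definitions, no named facts; axioms standard. WHAT THIS IS NOT: a proof of u010, of (16.1), or of
anything about Theorems 1–2 of the source or about Landau–Siegel zeros.

## References

* Y. Zhang, arXiv:2211.02515v1 (2022), §16 pp. 88–89, u001, u003, u006–u010 (tex L4404–L4449); §14
  p. 76 (definition of `Θ₂`). [cite: Zhang2022LandauSiegel, §16 p.89 (u010)]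
-/

noncomputable section

open Complex Real ComplexConjugate
open scoped LSeries.notation

namespace Literature.NumberTheory.LFunctions.Zhang2022.Step16u010

open Literature.NumberTheory.LFunctions.Zhang2022
open Literature.NumberTheory.LFunctions.Zhang2022.Skeleton
open Literature.NumberTheory.LFunctions.Zhang2022.Typed.Section16A
open Literature.NumberTheory.LFunctions.Zhang2022.Typed.Section16ALeaves

variable (c' : ℝ) {D : ℕ} [NeZero D] (χ : DirichletCharacter ℂ D) (x : Chr D)

/-! ## u007 as an `L`-series identity, and the summability of `Σ b₁(n)ψ(n)n^{−s}` -/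

omit [NeZero D] χ in
/-- The `ψ`-coefficients of `N(s+β,ψ)` have an everywhere summable `L`-series (finite support `n < 2T²`).
[cite: Zhang2022LandauSiegel, §6 p.30] -/
theorem LSeriesSummable_nN_psiFn (β s : ℂ) :
    LSeriesSummable (fun n => Typed.Section17.nN D β n * psiFn x n) s := by
  refine summable_of_ne_finset_zero (s := Finset.range ⌈2 * bigT D ^ 2⌉₊) fun n hn => ?_
  have hn' : ⌈2 * bigT D ^ 2⌉₊ ≤ n := by simpa using hn
  rcases eq_or_ne n 0 with rfl | h0
  · simp [LSeries.term]
  · have hreal : 2 * bigT D ^ 2 ≤ (n : ℝ) := le_trans (Nat.le_ceil _) (by exact_mod_cast hn')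
    rw [LSeries.term_of_ne_zero h0, Typed.Section17.nN_eq_zero_of_le D β hreal, zero_mul, zero_div]

/-- **u007 at every `s`**: `B(s,ψ)N(s+β₃,ψ) = Σ_n b₁(n)ψ(n)n^{−s}` as an `L`-series (both sides finite
sums; the typed χ-twisted `b1coef`). [cite: Zhang2022LandauSiegel, §16 p.89 (u007)] -/
theorem Bpoly_mul_Nchar_eq_LSeries (s : ℂ) :
    Bpoly χ x s * Nchar D (psiFn x) (s + beta3 c' D) = L (fun n => b1coef c' χ n * psiFn x n) s := by
  rw [Typed.Section17.Bpoly_eq_LSeries x χ s, Typed.Section17.Nchar_shift_eq_LSeries x (beta3 c' D) s,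
    ← LSeries_convolution' (Typed.Section17.LSeriesSummable_bcoef x χ s)
      (LSeriesSummable_nN_psiFn x (beta3 c' D) s),
    convolution_bcoef_nN_eq_b1coef c' χ x]

/-- `Σ b₁(n)ψ(n)n^{−s}` is summable at every `s` (it is the finite product `B·N`).
[cite: Zhang2022LandauSiegel, §16 p.89 (u007)] -/
theorem LSeriesSummable_b1coef_psiFn (s : ℂ) :
    LSeriesSummable (fun n => b1coef c' χ n * psiFn x n) s := by
  rw [← convolution_bcoef_nN_eq_b1coef c' χ x]
  exact (Typed.Section17.LSeriesSummable_bcoef x χ s).convolution (LSeriesSummable_nN_psiFn x _ s)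

/-! ## u006 + u007: `(L(s+β₁,ψ)/L(s,ψ))·B(s,ψ)N(s+β₃,ψ) = Σ_m κ₂*(m)ψ(m)m^{−s}` for `σ > 1` -/

omit [NeZero D] in
/-- `Re(s + β₁) = Re s` (`β₁ = ib₁` is purely imaginary). [cite: Zhang2022LandauSiegel, §2 (2.13)] -/
theorem add_beta1_re (s : ℂ) : (s + beta1 c' D).re = s.re := by
  rw [Complex.add_re, beta1_eq_b1_mul_I, Complex.mul_re, Complex.ofReal_re, Complex.ofReal_im,
    Complex.I_re, Complex.I_im]
  ring

/-- **u006 + u007** (kernel): for `Re s > 1`,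
`(L(s+β₁,ψ)/L(s,ψ))·(B(s,ψ)N(s+β₃,ψ)) = Σ_m κ₂*(m)ψ(m)m^{−s}` with `κ₂* = κ₂ ∗ b₁`
(`Typed.Section16A.kappa2Star`); the tree's `MeanSquareMajorant.LSeries_twist_conv_kappa₂` with
`DirichletCharacter.LFunction_eq_LSeries`. [cite: Zhang2022LandauSiegel, §16 p.89 (u006, u007, u010)] -/
theorem LRatio_mul_Bpoly_mul_Nchar_eq_tsum {s : ℂ} (hs : 1 < s.re) :
    x.ψ.LFunction (s + beta1 c' D) / x.ψ.LFunction s *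
        (Bpoly χ x s * Nchar D (psiFn x) (s + beta3 c' D)) =
      ∑' m : ℕ, kappa2Star c' χ m * x.ψ (m : ZMod x.p) * (m : ℂ) ^ (-s) := by
  have hre : 1 < (s + beta1 c' D).re := by rw [add_beta1_re]; exact hs
  -- the twisted `b₁`-series in Mathlib's `↗ψ * c` form
  have hfun : (↗x.ψ * b1coef c' χ) = fun n => b1coef c' χ n * psiFn x n := by
    funext n; simp [psiFn, mul_comm]
  have hc : LSeriesSummable (↗x.ψ * b1coef c' χ) s := by
    rw [hfun]; exact LSeriesSummable_b1coef_psiFn c' χ x s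
  have key := MeanSquareMajorant.LSeries_twist_conv_kappa₂ (b1 c' D) x.ψ hs hc
  -- right side as the `L`-series of `ψ·κ₂*`
  have hrhs : (∑' m : ℕ, kappa2Star c' χ m * x.ψ (m : ZMod x.p) * (m : ℂ) ^ (-s)) =
      L (↗x.ψ * MeanSquareMajorant.conv (kappa2 c' D) (b1coef c' χ)) s := by
    refine tsum_congr fun n => ?_
    rcases eq_or_ne n 0 with rfl | hn
    · simp [LSeries.term, kappa2Star, MeanSquareMajorant.conv]
    · rw [LSeries.term_of_ne_zero hn, Pi.mul_apply, kappa2Star, div_eq_mul_inv, Complex.cpow_neg]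
      ring
  rw [hrhs, kappa2, key, Bpoly_mul_Nchar_eq_LSeries, ← hfun,
    DirichletCharacter.LFunction_eq_LSeries _ hre, DirichletCharacter.LFunction_eq_LSeries _ hs,
    beta1_eq_b1_mul_I]

/-! ## u008 in the range of `Θ₂` -/

omit [NeZero D] χ in
/-- **u008, `Θ₂`-range form**: `K(1−s−β₂,ψ̄) = Σ_{1≤n≤⌊2P₄⌋} g̃₂(n)ψ̄(n)n^{s−1}` (the tree's
`step16_u008_holds` over `[1,⌈2P₄⌉)`; the two ranges differ at most by `n = 2P₄`, where `g̃₂` vanishes,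
and `n^{s−1} = 1/n^{1−s}`). [cite: Zhang2022LandauSiegel, §16 p.89 (u008)] -/
theorem Kchar_eq_sum_Icc (s : ℂ) :
    Kchar D (psiBarFn x) (1 - s - beta2 c' D) =
      ∑ n ∈ Finset.Icc 1 ⌊2 * P4 D⌋₊,
        gTilde16 c' D n * conj (x.ψ (n : ZMod x.p)) * (n : ℂ) ^ (s - 1) := by
  rw [step16_u008_holds c' D x s]
  have hP4 : 0 ≤ 2 * P4 D := mul_nonneg zero_le_two (P4_nonneg D)
  -- `[1,⌈2P₄⌉) ⊆ [1,⌊2P₄⌋]`, and the extra index (if any) is `n = 2P₄`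
  have hsub : Finset.Ico 1 ⌈2 * P4 D⌉₊ ⊆ Finset.Icc 1 ⌊2 * P4 D⌋₊ := by
    intro n hn
    rw [Finset.mem_Ico] at hn
    rw [Finset.mem_Icc]
    refine ⟨hn.1, ?_⟩
    have h := Nat.ceil_le_floor_add_one (2 * P4 D)
    omega
  rw [← Finset.sum_subset hsub]
  · refine Finset.sum_congr rfl fun n hn => ?_
    have hn1 : 1 ≤ n := (Finset.mem_Ico.mp hn).1
    have hn0 : (n : ℂ) ≠ 0 := by exact_mod_cast (show n ≠ 0 by omega)
    rw [psiBarFn, show s - 1 = -(1 - s) by ring, Complex.cpow_neg, div_eq_mul_inv]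
  · intro n hn hnot
    have hn1 : 1 ≤ n := (Finset.mem_Icc.mp hn).1
    have hle : n ≤ ⌊2 * P4 D⌋₊ := (Finset.mem_Icc.mp hn).2
    have hge : ⌈2 * P4 D⌉₊ ≤ n := by
      by_contra h
      exact hnot (Finset.mem_Ico.mpr ⟨hn1, not_le.mp h⟩)
    have h1 : (n : ℝ) ≤ 2 * P4 D := by
      have := Nat.floor_le hP4
      calc (n : ℝ) ≤ ⌊2 * P4 D⌋₊ := by exact_mod_cast hle
        _ ≤ 2 * P4 D := this
    have h2 : 2 * P4 D ≤ (n : ℝ) := le_trans (Nat.le_ceil _) (by exact_mod_cast hge)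
    have hn0 : (0 : ℝ) < n := by exact_mod_cast (show 0 < n by omega)
    rw [gTilde16_eq_zero_of_le c' hn0 h2]
    simp

/-! ## The integrand of `I₃⁺(ψ)` on `Re s > 1` is the integrand of `Θ₂(β₁,𝐤₂*,𝐚₂*)` -/

/-- **u010, pointwise**: for `Re s > 1`, `𝒦₂(s,ψ)ω(s)` (`𝒦₂ = Z(s,χψ)⁻¹·(L(s+β₁,ψ)/L(s,ψ))·B(s,ψ)
N(s+β₃,ψ)K(1−s−β₂,ψ̄)`, u001) equals
`Z(s,χψ)⁻¹(Σ_m κ₂*(m)ψ(m)m^{−s})(Σ_{n≤2P₄} g̃₂(n)ψ̄(n)n^{s−1})ω(s)`, the integrand of `Θ₂(β₁,𝐤₂*,𝐚₂*)`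
at `ψ`. [cite: Zhang2022LandauSiegel, §16 p.89 (u010)] -/
theorem calK2_mul_omega_eq_theta2Integrand {s : ℂ} (hs : 1 < s.re) :
    calK2 c' χ x s * omegaW D s =
      (Zpc χ x s)⁻¹ * (∑' m : ℕ, kappa2Star c' χ m * x.ψ (m : ZMod x.p) * (m : ℂ) ^ (-s)) *
        (∑ n ∈ Finset.Icc 1 ⌊2 * P4 D⌋₊,
          (fun n : ℕ => gTilde16 c' D n) n * conj (x.ψ (n : ZMod x.p)) * (n : ℂ) ^ (s - 1)) *
        omegaW D s := by
  rw [← LRatio_mul_Bpoly_mul_Nchar_eq_tsum c' χ x hs, ← Kchar_eq_sum_Icc c' x s, calK2]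
  ring

/-- **`I₃(ψ)` on `𝔍(1)` is the `ψ`-term of `Θ₂(β₁,𝐤₂*,𝐚₂*)`** (the segment `𝔍(1) = 1 + s₀ + i[−𝓛₁,𝓛₁]`
lies on `Re s = 3/2`). [cite: Zhang2022LandauSiegel, §16 p.89 (u010); §14 p.76] -/
theorem I3pm_one_eq_segInt :
    I3pm c' χ x 1 =
      Lemma81.segInt (t0 D) (ell1 D) 1 fun s =>
        (Zpc χ x s)⁻¹ * (∑' m : ℕ, kappa2Star c' χ m * x.ψ (m : ZMod x.p) * (m : ℂ) ^ (-s)) *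
          (∑ n ∈ Finset.Icc 1 ⌊2 * P4 D⌋₊,
            (fun n : ℕ => gTilde16 c' D n) n * conj (x.ψ (n : ZMod x.p)) * (n : ℂ) ^ (s - 1)) *
          omegaW D s := by
  rw [I3pm, Complex.ofReal_one, Lemma81.segInt_def, Lemma81.segInt_def]
  congr 1
  refine intervalIntegral.integral_congr fun v _ => ?_
  have hre : 1 < ((1 : ℂ) + SmoothWeight.s0 (t0 D) + v * I).re := by
    simp [SmoothWeight.s0]
  exact calK2_mul_omega_eq_theta2Integrand c' χ x hre

/-- **u010 as an identity on `𝔍(1)`**: `Σ_{ψ∈Ψ₁}(p_ψt₀)^{β₁}·(1/2πi)∫_{𝔍(1)}𝒦₂(s,ψ)ω(s)ds =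
Θ₂(β₁,𝐤₂*,𝐚₂*)` with `κ₂* = κ₂ ∗ b₁`, `a₂* = g̃₂` — EXACT, for every modulus `D` and every `χ`
(`Skeleton.Theta2` sums over `Ψ₁` and integrates over `𝔍(1)`). What remains of u010 after this identity is
analytic: the residue step u002, `I₃⁻ ≪ ε` (u004) and the contour move `𝔍(α) → 𝔍(1)`.
[cite: Zhang2022LandauSiegel, §16 p.89 (u010)] -/
theorem sum_I3pm_one_eq_Theta2 :
    ∑ y ∈ finsetOf (PsiOne χ), (((y.p : ℝ) * t0 D : ℝ) : ℂ) ^ beta1 c' D * I3pm c' χ y 1 =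
      Theta2 χ (beta1 c' D) (kappa2Star c' χ) (fun n : ℕ => gTilde16 c' D n) := by
  rw [Theta2]
  refine Finset.sum_congr rfl fun y _ => ?_
  rw [I3pm_one_eq_segInt c' χ y]

end Literature.NumberTheory.LFunctions.Zhang2022.Step16u010
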